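import Summits.CriticalPhenomena.PercolationContinuityZ3.Theorems.SahiAEOpenBandLines

/-!
# Open bands in every dimension: one-dimensional regularity of the line gaps

Support file of the Sahi cell (`prim-sahi`, typer seat, generation 25; `--supports stmt-CriticalPhenomena-4575`).
Small definitions (`BandFamily`, `lineGap`), theorems otherwise; no named facts, no sorries.

Fourth file of the structure theorem for densities with zeros in every dimension.  Two ingredients:

* `exists_monotone_ae_eq_Icc` — **one-dimensional regularisation**: a function `α : ℝ → ℝ` which is non-decreasing
  on almost every comparable pair of an open interval `(a, b)` agrees almost everywhere on any compact
  `[a', b'] ⊆ (a, b)` with an honest monotone function (Fubini gives a co-null set of regular heights on which `α`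
  is honestly monotone and bounded; `MonotoneOn.exists_monotone_extension`).
* `BandFamily U φ c` — the dense generic family of base points of an open band (`exists_bandFamily`, from
  `exists_openBand_seq`), and the **line gaps** `lineGap φ c i l m t = φ(c_l; i := t) − φ(c_m; i := t)` between
  the parallel axis lines of two members: if `c_m ≤ c_l` off the coordinate `i` and both lines run in `U` over
  `(a, b)`, the gap is non-decreasing on almost every comparable pair of heights (`ae_monotone_lineGap`, generic
  pairs relative to `U`) and hence has an honest monotone version on compact sub-intervals
  (`exists_monotone_lineGap`).

Since honest monotone functions are continuous off a countable set, these versions control the one-dimensional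
factors of `exp(φ − lineSum)` from the lower-left at almost every height (`SahiAEOpenBandChart.lean`,
`SahiAEOpenBandVersion.lean`).  No sorries, no new axioms.
-/

noncomputable section

namespace Summit.CriticalPhenomena.PercolationContinuityZ3.Theorems.SahiAEFourFunctions

open MeasureTheory Set Filter Topology Function Metric
open scoped ENNReal NNReal

variable {ι : Type*} [Fintype ι] [DecidableEq ι]

/-! ### One-dimensional regularisation -/

/-- A co-null property of reals holds somewhere in any non-empty open set. [folklore] -/
theorem Real.exists_of_ae_of_isOpen {Q : ℝ → Prop} (hQ : ∀ᵐ t ∂(volume : Measure ℝ), Q t) {O : Set ℝ}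
    (hO : IsOpen O) (hne : O.Nonempty) : ∃ t ∈ O, Q t := by
  by_contra hcon
  push Not at hcon
  have h0 : volume O = 0 := measure_mono_null (fun t ht hq => hcon t ht hq) (ae_iff.1 hQ)
  exact (hO.measure_pos volume hne).ne' h0

/-- **One-dimensional regularisation.**  If `α : ℝ → ℝ` is non-decreasing on almost every comparable pair of the
open interval `(a, b)`, then on every compact `[a', b'] ⊆ (a, b)` it agrees almost everywhere with an honest monotone
function. [this work] -/
theorem exists_monotone_ae_eq_Icc {α : ℝ → ℝ} {a b a' b' : ℝ} (ha : a < a') (hab : a' ≤ b') (hb : b' < b)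
    (hα : ∀ᵐ z ∂(volume : Measure ℝ).prod (volume : Measure ℝ),
      z.1 ∈ Ioo a b → z.2 ∈ Ioo a b → z.1 ≤ z.2 → α z.1 ≤ α z.2) :
    ∃ g : ℝ → ℝ, Monotone g ∧ ∀ᵐ t ∂(volume : Measure ℝ), t ∈ Icc a' b' → g t = α t := by
  -- regular heights
  have h1 : ∀ᵐ t ∂(volume : Measure ℝ), ∀ᵐ s ∂(volume : Measure ℝ),
      t ∈ Ioo a b → s ∈ Ioo a b → t ≤ s → α t ≤ α s := Measure.ae_ae_of_ae_prod hα
  have h2 : ∀ᵐ t ∂(volume : Measure ℝ), ∀ᵐ s ∂(volume : Measure ℝ),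
      s ∈ Ioo a b → t ∈ Ioo a b → s ≤ t → α s ≤ α t := by
    have hsw := (Measure.measurePreserving_swap (μ := (volume : Measure ℝ))
      (ν := (volume : Measure ℝ))).quasiMeasurePreserving.ae hα
    have := Measure.ae_ae_of_ae_prod (p := fun z : ℝ × ℝ =>
      z.2 ∈ Ioo a b → z.1 ∈ Ioo a b → z.2 ≤ z.1 → α z.2 ≤ α z.1) (by
        filter_upwards [hsw] with z hz using hz)
    filter_upwards [this] with t ht
    filter_upwards [ht] with s hs using hs
  set R : Set ℝ := {t | t ∈ Ioo a b ∧ (∀ᵐ s ∂(volume : Measure ℝ), s ∈ Ioo a b → t ≤ s → α t ≤ α s) ∧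
    (∀ᵐ s ∂(volume : Measure ℝ), s ∈ Ioo a b → s ≤ t → α s ≤ α t)} with hR
  have hRae : ∀ᵐ t ∂(volume : Measure ℝ), t ∈ Ioo a b → t ∈ R := by
    filter_upwards [h1, h2] with t ht1 ht2 htJ
    refine ⟨htJ, ?_, ?_⟩
    · filter_upwards [ht1] with s hs hsJ hts using hs htJ hsJ hts
    · filter_upwards [ht2] with s hs hsJ hst using hs hsJ htJ hst
  -- `α` is honestly monotone on `R`
  have hmono : MonotoneOn α R := by
    intro t ht t' ht' htt'
    rcases htt'.eq_or_lt with h | hlt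
    · rw [h]
    · obtain ⟨s, hsW, hs⟩ := Real.exists_of_ae_of_isOpen (ht.2.1.and ht'.2.2) isOpen_Ioo (nonempty_Ioo.2 hlt)
      have hsJ : s ∈ Ioo a b := ⟨ht.1.1.trans hsW.1, hsW.2.trans ht'.1.2⟩
      exact (hs.1 hsJ hsW.1.le).trans (hs.2 hsJ hsW.2.le)
  -- bounds on `[a', b']` from regular heights outside it
  obtain ⟨r₁, hr₁, hr₁R⟩ := Real.exists_of_ae_of_isOpen hRae isOpen_Ioo (nonempty_Ioo.2 ha)
  obtain ⟨r₂, hr₂, hr₂R⟩ := Real.exists_of_ae_of_isOpen hRae isOpen_Ioo (nonempty_Ioo.2 hb)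
  have hr₁R' : r₁ ∈ R := hr₁R ⟨hr₁.1, hr₁.2.trans_le (hab.trans hb.le)⟩
  have hr₂R' : r₂ ∈ R := hr₂R ⟨(ha.trans_le hab).trans hr₂.1, hr₂.2⟩
  set S : Set ℝ := R ∩ Icc a' b' with hS
  have hmonoS : MonotoneOn α S := hmono.mono Set.inter_subset_left
  have hbdd : BddBelow (α '' S) := ⟨α r₁, by
    rintro _ ⟨t, ht, rfl⟩
    exact hmono hr₁R' ht.1 (hr₁.2.le.trans ht.2.1)⟩
  have hbda : BddAbove (α '' S) := ⟨α r₂, by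
    rintro _ ⟨t, ht, rfl⟩
    exact hmono ht.1 hr₂R' (ht.2.2.trans hr₂.1.le)⟩
  obtain ⟨g, hg, heq⟩ := hmonoS.exists_monotone_extension hbdd hbda
  refine ⟨g, hg, ?_⟩
  filter_upwards [hRae] with t ht htI
  exact (heq ⟨ht ⟨ha.trans_le htI.1, htI.2.trans_lt hb⟩, htI⟩).symm

/-! ### The dense generic family of an open band -/

/-- **A dense generic family of base points** of the open band `U` for `φ` (as produced by `exists_openBand_seq`):
members of `U`, dense in `U`, each generic for every patched function, all pairs generic relative to `U`.
[this work] -/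
structure BandFamily (U : Set (ι → ℝ)) (φ : (ι → ℝ) → ℝ) (c : ℕ → ι → ℝ) : Prop where
  mem : ∀ k, c k ∈ U
  dense : ∀ O : Set (ι → ℝ), IsOpen O → O.Nonempty → O ⊆ U → ∃ k, c k ∈ O
  genAt : ∀ k j, GenAt (patch φ j) (c k)
  pairGen : ∀ k l, k ≠ l → PairGenOn U φ (c k) (c l)

/-- A dense generic family exists for a non-empty open set. [this work] -/
theorem exists_bandFamily {U : Set (ι → ℝ)} (hUo : IsOpen U) (hne : U.Nonempty) {φ : (ι → ℝ) → ℝ}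
    (hφ : Measurable φ)
    (hsmU : ∀ᵐ q ∂(volume : Measure (ι → ℝ)).prod volume,
      q.1 ∈ U → q.2 ∈ U → φ q.1 + φ q.2 ≤ φ (q.1 ⊓ q.2) + φ (q.1 ⊔ q.2)) :
    ∃ c : ℕ → ι → ℝ, BandFamily U φ c := by
  obtain ⟨c, h1, h2, h3, h4⟩ := exists_openBand_seq hUo hne hφ hsmU
  exact ⟨c, ⟨h1, h2, h3, h4⟩⟩

/-! ### Line gaps between parallel family lines -/

omit [Fintype ι] in
/-- **The line gap** `lineGap φ c i l m t = φ(c_l; i := t) − φ(c_m; i := t)` between the axis lines of `c_l` and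
`c_m` in direction `i`. [this work] -/
def lineGap (φ : (ι → ℝ) → ℝ) (c : ℕ → ι → ℝ) (i : ι) (l m : ℕ) (t : ℝ) : ℝ :=
  φ (update (c l) i t) - φ (update (c m) i t)

omit [Fintype ι] in
/-- The line gap is measurable in the height. [folklore] -/
theorem measurable_lineGap {φ : (ι → ℝ) → ℝ} (hφ : Measurable φ) (c : ℕ → ι → ℝ) (i : ι) (l m : ℕ) :
    Measurable (lineGap φ c i l m) :=
  (hφ.comp (measurable_update (c l) (a := i))).sub (hφ.comp (measurable_update (c m) (a := i)))

/-- **The line gap above a lower line is non-decreasing on almost every comparable pair of heights** at which both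
lines run in `U` (generic pairs relative to `U`; for `l = m` the gap vanishes). [this work] -/
theorem ae_monotone_lineGap {U : Set (ι → ℝ)} {φ : (ι → ℝ) → ℝ} {c : ℕ → ι → ℝ} (hF : BandFamily U φ c)
    {i : ι} {l m : ℕ} (hle : ∀ j, j ≠ i → c m j ≤ c l j) {a b : ℝ}
    (hm : ∀ s ∈ Ioo a b, update (c m) i s ∈ U) (hl : ∀ s ∈ Ioo a b, update (c l) i s ∈ U) :
    ∀ᵐ z ∂(volume : Measure ℝ).prod (volume : Measure ℝ),
      z.1 ∈ Ioo a b → z.2 ∈ Ioo a b → z.1 ≤ z.2 → lineGap φ c i l m z.1 ≤ lineGap φ c i l m z.2 := by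
  by_cases hml : m = l
  · subst hml
    exact Eventually.of_forall fun z _ _ _ => by simp [lineGap]
  · filter_upwards [ae_monotone_lineDiff (hF.pairGen m l hml) hle] with z hz h1 h2 h12
    exact hz h12 (hm _ h1) (hl _ h1) (hm _ h2) (hl _ h2)

/-- **Honest monotone versions of the line gaps**: under the hypotheses of `ae_monotone_lineGap`, on every compact
`[a', b'] ⊆ (a, b)` the gap agrees almost everywhere with a monotone function. [this work] -/
theorem exists_monotone_lineGap {U : Set (ι → ℝ)} {φ : (ι → ℝ) → ℝ} {c : ℕ → ι → ℝ} (hF : BandFamily U φ c)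
    {i : ι} {l m : ℕ} (hle : ∀ j, j ≠ i → c m j ≤ c l j) {a b a' b' : ℝ} (ha : a < a') (hab : a' ≤ b') (hb : b' < b)
    (hm : ∀ s ∈ Ioo a b, update (c m) i s ∈ U) (hl : ∀ s ∈ Ioo a b, update (c l) i s ∈ U) :
    ∃ g : ℝ → ℝ, Monotone g ∧ ∀ᵐ t ∂(volume : Measure ℝ), t ∈ Icc a' b' → g t = lineGap φ c i l m t :=
  exists_monotone_ae_eq_Icc ha hab hb (ae_monotone_lineGap hF hle hm hl)

/-! ### Honest versions chosen once and for all, indexed by rational windows -/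

/-- The rational window `w = (a, a', b', b)` as real numbers. [folklore] -/
def winLo (w : ℚ × ℚ × ℚ × ℚ) : ℝ := (w.1 : ℝ)

/-- Inner left end of the window. [folklore] -/
def winLo' (w : ℚ × ℚ × ℚ × ℚ) : ℝ := (w.2.1 : ℝ)

/-- Inner right end of the window. [folklore] -/
def winHi' (w : ℚ × ℚ × ℚ × ℚ) : ℝ := (w.2.2.1 : ℝ)

/-- Outer right end of the window. [folklore] -/
def winHi (w : ℚ × ℚ × ℚ × ℚ) : ℝ := (w.2.2.2 : ℝ)

omit [Fintype ι] in
/-- **Validity of a one-dimensional chart** `(i, l, m, w)`: the window is non-degenerate, `c_m ≤ c_l` off `i`, and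
both lines run in `U` over the outer window. [this work] -/
def GapValid (U : Set (ι → ℝ)) (c : ℕ → ι → ℝ) (i : ι) (l m : ℕ) (w : ℚ × ℚ × ℚ × ℚ) : Prop :=
  winLo w < winLo' w ∧ winLo' w ≤ winHi' w ∧ winHi' w < winHi w ∧ (∀ j, j ≠ i → c m j ≤ c l j) ∧
    (∀ s ∈ Ioo (winLo w) (winHi w), update (c m) i s ∈ U) ∧ ∀ s ∈ Ioo (winLo w) (winHi w), update (c l) i s ∈ U

open Classical in
omit [Fintype ι] in
/-- **The honest gap**: a monotone function agreeing almost everywhere on the inner window with the line gap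
`lineGap φ c i l m` (when the chart is valid and such a function exists; the zero function otherwise). [this work] -/
def honestGap (φ : (ι → ℝ) → ℝ) (c : ℕ → ι → ℝ) (i : ι) (l m : ℕ) (w : ℚ × ℚ × ℚ × ℚ) : ℝ → ℝ :=
  if h : ∃ g : ℝ → ℝ, Monotone g ∧ ∀ᵐ t ∂(volume : Measure ℝ), t ∈ Icc (winLo' w) (winHi' w) →
      g t = lineGap φ c i l m t then Classical.choose h else fun _ => 0

omit [Fintype ι] in
/-- The honest gap is monotone. [this work] -/
theorem monotone_honestGap (φ : (ι → ℝ) → ℝ) (c : ℕ → ι → ℝ) (i : ι) (l m : ℕ)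
    (w : ℚ × ℚ × ℚ × ℚ) : Monotone (honestGap φ c i l m w) := by
  classical
  unfold honestGap
  split_ifs with h
  · exact (Classical.choose_spec h).1
  · exact monotone_const

/-- **For a valid chart the honest gap is a version of the line gap on the inner window.** [this work] -/
theorem ae_honestGap_eq {U : Set (ι → ℝ)} {φ : (ι → ℝ) → ℝ} {c : ℕ → ι → ℝ} (hF : BandFamily U φ c)
    {i : ι} {l m : ℕ} {w : ℚ × ℚ × ℚ × ℚ} (hv : GapValid U c i l m w) :
    ∀ᵐ t ∂(volume : Measure ℝ), t ∈ Icc (winLo' w) (winHi' w) → honestGap φ c i l m w t = lineGap φ c i l m t := by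
  classical
  obtain ⟨h1, h2, h3, hle, hm, hl⟩ := hv
  have h : ∃ g : ℝ → ℝ, Monotone g ∧ ∀ᵐ t ∂(volume : Measure ℝ), t ∈ Icc (winLo' w) (winHi' w) →
      g t = lineGap φ c i l m t := exists_monotone_lineGap hF hle h1 h2 h3 hm hl
  have e : honestGap φ c i l m w = Classical.choose h := by
    unfold honestGap; rw [dif_pos h]
  rw [e]
  exact (Classical.choose_spec h).2

/-- **Almost every height is good for every one-dimensional chart**: for almost every `p ∈ ℝ^ι`, for every valid
chart `(i, l, m, w)` with `pᵢ` in the inner window, the honest gap equals the line gap at `pᵢ` and is continuous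
there (countably many charts; monotone functions are continuous off a countable set; coordinate projections pull
null sets back to null sets). [this work] -/
theorem ae_good_heights {U : Set (ι → ℝ)} {φ : (ι → ℝ) → ℝ} {c : ℕ → ι → ℝ} (hF : BandFamily U φ c) :
    ∀ᵐ p ∂(volume : Measure (ι → ℝ)), ∀ (i : ι) (l m : ℕ) (w : ℚ × ℚ × ℚ × ℚ), GapValid U c i l m w →
      p i ∈ Icc (winLo' w) (winHi' w) →
        honestGap φ c i l m w (p i) = lineGap φ c i l m (p i) ∧ ContinuousAt (honestGap φ c i l m w) (p i) := by
  have hcount : ∀ (i : ι) (l m : ℕ) (w : ℚ × ℚ × ℚ × ℚ),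
      ∀ᵐ p ∂(volume : Measure (ι → ℝ)), GapValid U c i l m w → p i ∈ Icc (winLo' w) (winHi' w) →
        honestGap φ c i l m w (p i) = lineGap φ c i l m (p i) ∧
          ContinuousAt (honestGap φ c i l m w) (p i) := by
    intro i l m w
    by_cases hv : GapValid U c i l m w
    · have h1 : ∀ᵐ t ∂(volume : Measure ℝ), t ∈ Icc (winLo' w) (winHi' w) →
          honestGap φ c i l m w t = lineGap φ c i l m t := ae_honestGap_eq hF hv
      have h2 : ∀ᵐ t ∂(volume : Measure ℝ), ContinuousAt (honestGap φ c i l m w) t := by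
        have hc := (monotone_honestGap φ c i l m w).countable_not_continuousAt
        rw [ae_iff]
        simpa only [not_not] using hc.measure_zero volume
      have h12 := (SahiAESeparableTilt.quasiMeasurePreserving_eval (ι := ι) i).ae (h1.and h2)
      filter_upwards [h12] with p hp _ hpi
      exact ⟨hp.1 hpi, hp.2⟩
    · exact Eventually.of_forall fun p hv' => absurd hv' hv
  have H := ae_all_iff.2 fun i : ι => ae_all_iff.2 fun l : ℕ => ae_all_iff.2 fun m : ℕ =>
    ae_all_iff.2 fun w : ℚ × ℚ × ℚ × ℚ => hcount i l m w
  filter_upwards [H] with p hp i l m w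
  exact hp i l m w

end Summit.CriticalPhenomena.PercolationContinuityZ3.Theorems.SahiAEFourFunctions
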